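import Mathlib
import Literature.Computability.AlgebraicComplexity.HessianAtOrigin
import Literature.Computability.AlgebraicComplexity.MignonRessayreBound
import Literature.Computability.AlgebraicComplexity.LandsbergRessayreNormalForm
import Summits.ValiantsHypothesis.ValiantsHypothesis.Theorems.RefutationDegreeMrCalibrationMinors
import Summits.ValiantsHypothesis.ValiantsHypothesis.Theorems.RefutationDegreeBeyondHessianNsPointLemma

/-!
# The Mignon–Ressayre minor as a jet-coordinate certificate (crux `BeyondHessianNs`)

Helper file for crux item stmt-ValiantsHypothesis-5641 (`RefutationDegree.BeyondHessianNs`),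
stub `stub_mrJetInstance` of the line `Sketch`: NON-VACUITY of the jet-calibration pipeline.

The line reduces the crux to finding a polynomial `Ψ̃` in JET COORDINATES (variables `X_μ`
indexed by exponents `μ : Fin n × Fin n →₀ ℕ`; "`Ψ̃(g)`" means `eval (fun μ => coeff μ g) Ψ̃`)
vanishing identically on `g = det (Λ_{i₀} + Σ_e x_e Z_e)` for all complex `Z` but not at
`per_n(X + y)` for a smooth zero `y` of `per_n`. This file shows that Mignon–Ressayre's
certificate is such an instance, of degree `2m + 1`, whenever `2m + 1 ≤ n²`:

* the Hessian entry `g ↦ (∂_s ∂_t g)(0)` is the degree-one jet polynomial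
  `h_{st} = c_{st} · X_{e_s + e_t}` with `c_{st} = 2` if `s = t` and `1` otherwise
  (`eval_coeff_hessFunctional`), so every minor of the Hessian at the origin is a jet polynomial
  of degree at most its size (`eval_coeff_det_hessFunctional`,
  `totalDegree_det_hessFunctional_le`);
* at the Mignon–Ressayre point `y₀` (`n = m' + 3`) the Hessian of `per_n(X + y₀)` at `0` is
  `m'! · mrHess`, invertible (tree `hess0_transl_mrPoint_perPoly`, `mrHess_mulVec_injective`), so
  some `(2m+1) × (2m+1)` minor of it is non-zero (tree `exists_submatrix_det_ne_zero`); `Ψ` is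
  the corresponding minor of `(h_{st})`;
* for every complex `Z`, `A = Λ_{i₀} + Σ_e X_e Z_e` has affine entries and
  `det A(0) = det Λ_{i₀} = 0`, so `rank H(det A)(0) ≤ 2m` (tree `rank_hess0_det_le`) and the
  minor vanishes (tree `det_submatrix_eq_zero_of_rank_lt`);
* `y₀` is a smooth zero: `per(y₀) = 0` (tree `eval_mrPoint_perPoly`) and, by Euler's identity
  `H y₀ = (n - 1) ∇per(y₀)` (`euler_transl`) with `H` injective and `y₀ ≠ 0`, some partial
  derivative `∂_e per (y₀)` is non-zero.

References: T. Mignon, N. Ressayre, IMRN 2004, Thm. 1.1 and §§2–3; J. M. Landsberg, *Geometry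
and Complexity Theory* (2017), §6.4.6.
-/

noncomputable section

-- single-conjunct layout: Sub = Summit, duplicated namespace component intended
set_option linter.dupNamespace false

namespace Summit.ValiantsHypothesis.ValiantsHypothesis.Theorems.RefutationDegreeBeyondHessianNs

open MvPolynomial Matrix
open Literature.Computability.AlgebraicComplexity
open Summit.ValiantsHypothesis.ValiantsHypothesis.Theorems.RefutationDegreeMrCalibration

section HessianFunctional

variable {σ : Type*} [DecidableEq σ] {K : Type*} [CommRing K]

/-- **The Hessian entry as a jet polynomial.** For every polynomial `g`, the entry `(s, t)` of
its Hessian at the origin is the value at the coefficient vector of `g` of the degree-one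
polynomial `c_{st} · X_{e_s + e_t}`, `c_{st} = 2` if `s = t` and `1` otherwise (`coeff_pderiv`
twice). [folklore] -/
theorem eval_coeff_hessFunctional (g : MvPolynomial σ K) (s t : σ) :
    eval (fun μ => coeff μ g) (C (if s = t then (2 : K) else 1) *
        X (Finsupp.single s 1 + Finsupp.single t 1) : MvPolynomial (σ →₀ ℕ) K) = hess0 g s t := by
  rw [hess0_apply, map_mul, eval_C, eval_X]
  show _ = coeff 0 (pderiv s (pderiv t g))
  rw [coeff_pderiv, coeff_pderiv, zero_add, Finsupp.single_apply]
  simp only [Finsupp.coe_zero, Pi.zero_apply, Nat.cast_zero, zero_add, mul_one]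
  split_ifs <;> push_cast <;> ring

/-- **Minors of the Hessian as jet polynomials**: the `k × k` minor with rows `r` and columns `c`
of the Hessian of `g` at the origin is the value at the coefficients of `g` of the determinant of
the matrix of jet polynomials `(c_{r a, c b} X_{e_{r a} + e_{c b}})_{a b}`. [folklore] -/
theorem eval_coeff_det_hessFunctional {k : ℕ} (g : MvPolynomial σ K) (r c : Fin k → σ) :
    eval (fun μ => coeff μ g)
        (Matrix.of fun a b => (C (if r a = c b then (2 : K) else 1) *
          X (Finsupp.single (r a) 1 + Finsupp.single (c b) 1) : MvPolynomial (σ →₀ ℕ) K)).det =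
      ((hess0 g).submatrix r c).det := by
  rw [RingHom.map_det, RingHom.mapMatrix_apply]
  congr 1
  ext a b
  rw [Matrix.map_apply, Matrix.of_apply, Matrix.submatrix_apply, eval_coeff_hessFunctional]

/-- The jet polynomial of a `k × k` minor of the Hessian has total degree `≤ k`. [folklore] -/
theorem totalDegree_det_hessFunctional_le [Nontrivial K] {k : ℕ} (r c : Fin k → σ) :
    (Matrix.of fun a b => (C (if r a = c b then (2 : K) else 1) *
        X (Finsupp.single (r a) 1 + Finsupp.single (c b) 1) :
          MvPolynomial (σ →₀ ℕ) K)).det.totalDegree ≤ k := by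
  have h := totalDegree_det_le (Matrix.of fun a b => (C (if r a = c b then (2 : K) else 1) *
      X (Finsupp.single (r a) 1 + Finsupp.single (c b) 1) : MvPolynomial (σ →₀ ℕ) K)) (d := 1)
    (fun a b => by
      rw [Matrix.of_apply]
      refine (totalDegree_mul _ _).trans ?_
      rw [totalDegree_C, totalDegree_X, zero_add])
  simpa using h

end HessianFunctional

section Pencil

variable {K : Type*} [Field K] {σ : Type*} [Fintype σ] {m : ℕ}

/-- The entries of the pencil `Λ_{i₀} + Σ_e X_e Z_e` are affine linear forms. [folklore] -/
theorem totalDegree_lamPencil_le (i₀ : Fin m) (Z : σ → Matrix (Fin m) (Fin m) K) (i j : Fin m) :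
    (((lamMatrix K i₀).map C + ∑ e : σ, (X e : MvPolynomial σ K) • (Z e).map
      (C : K →+* MvPolynomial σ K) : Matrix (Fin m) (Fin m) (MvPolynomial σ K)) i j).totalDegree
        ≤ 1 := by
  rw [Matrix.add_apply, Matrix.map_apply, Matrix.sum_apply]
  refine (totalDegree_add _ _).trans (max_le ?_ ?_)
  · rw [totalDegree_C]; exact Nat.zero_le _
  · refine totalDegree_finsetSum_le fun e _ => ?_
    rw [Matrix.smul_apply, Matrix.map_apply, smul_eq_mul]
    refine (totalDegree_mul _ _).trans ?_
    rw [totalDegree_C, add_zero, totalDegree_X]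

/-- The pencil `Λ_{i₀} + Σ_e X_e Z_e` is singular at the origin:
`det (Λ_{i₀} + Σ_e X_e Z_e)(0) = det Λ_{i₀} = 0`. [folklore] -/
theorem constantCoeff_det_lamPencil (i₀ : Fin m) (Z : σ → Matrix (Fin m) (Fin m) K) :
    constantCoeff ((lamMatrix K i₀).map C + ∑ e : σ, (X e : MvPolynomial σ K) • (Z e).map
      (C : K →+* MvPolynomial σ K) : Matrix (Fin m) (Fin m) (MvPolynomial σ K)).det = 0 := by
  rw [RingHom.map_det, RingHom.mapMatrix_apply]
  have hmap : ((lamMatrix K i₀).map C + ∑ e : σ, (X e : MvPolynomial σ K) • (Z e).map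
      (C : K →+* MvPolynomial σ K) : Matrix (Fin m) (Fin m) (MvPolynomial σ K)).map
        (constantCoeff : MvPolynomial σ K →+* K) = lamMatrix K i₀ := by
    ext i j
    rw [Matrix.map_apply, Matrix.add_apply, Matrix.map_apply, Matrix.sum_apply, map_add,
      constantCoeff_C, map_sum]
    simp [Matrix.smul_apply, Matrix.map_apply, smul_eq_mul, constantCoeff_X]
  rw [hmap, lamMatrix, Matrix.det_diagonal]
  exact Finset.prod_eq_zero (Finset.mem_univ i₀) (if_pos rfl)

end Pencil

/-- **The registered stub `stub_mrJetInstance`** (line `Sketch`, crux `BeyondHessianNs`): for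
`3 ≤ n` and `2m + 1 ≤ n²`, the Mignon–Ressayre point `y₀` of `{per_n = 0}` is a smooth zero, and
a suitable `(2m+1) × (2m+1)` minor of the Hessian-at-the-origin functional is a jet polynomial
`Ψ` of degree `≤ 2m + 1` with `Ψ(per_n(X + y₀)) ≠ 0` and `Ψ(det (Λ_{i₀} + Σ_e X_e Z_e)) = 0` for
every complex `Z` (module docstring; Mignon–Ressayre 2004, Thm. 1.1, read in jet coordinates).
[cite: MignonRessayre2004, Thm. 1.1] -/
theorem stub_mrJetInstance : ∀ (n m : ℕ) (i₀ : Fin m), 3 ≤ n → 2 * m + 1 ≤ n ^ 2 →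
    ∃ (y : Fin n × Fin n → ℂ) (e : Fin n × Fin n) (Ψ : MvPolynomial (Fin n × Fin n →₀ ℕ) ℂ),
      MvPolynomial.eval y (Literature.Computability.AlgebraicComplexity.perPoly (Fin n) ℂ) = 0 ∧
      MvPolynomial.eval y (MvPolynomial.pderiv e
        (Literature.Computability.AlgebraicComplexity.perPoly (Fin n) ℂ)) ≠ 0 ∧
      Ψ.totalDegree ≤ 2 * m + 1 ∧
      MvPolynomial.eval (fun μ => MvPolynomial.coeff μ
        (Literature.Computability.AlgebraicComplexity.transl y
          (Literature.Computability.AlgebraicComplexity.perPoly (Fin n) ℂ))) Ψ ≠ 0 ∧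
      ∀ Z : Fin n × Fin n → Matrix (Fin m) (Fin m) ℂ,
        MvPolynomial.eval (fun μ => MvPolynomial.coeff μ
          (((Literature.Computability.AlgebraicComplexity.lamMatrix ℂ i₀).map MvPolynomial.C +
            ∑ e : Fin n × Fin n, (MvPolynomial.X e : MvPolynomial (Fin n × Fin n) ℂ) •
              (Z e).map (MvPolynomial.C : ℂ →+* MvPolynomial (Fin n × Fin n) ℂ) :
                Matrix (Fin m) (Fin m) (MvPolynomial (Fin n × Fin n) ℂ)).det)) Ψ = 0 := by
  intro n m i₀ hn hmn
  obtain ⟨m', rfl⟩ : ∃ m', n = m' + 3 := ⟨n - 3, by omega⟩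
  -- the Hessian of the permanent at the Mignon–Ressayre point and a non-zero `(2m+1)`-minor
  have hHperU : IsUnit (hess0 (transl (mrPoint ℂ m') (perPoly (Fin (m' + 3)) ℂ))) := by
    rw [hess0_transl_mrPoint_perPoly, Matrix.isUnit_iff_isUnit_det, Matrix.det_smul,
      isUnit_iff_ne_zero]
    refine mul_ne_zero (pow_ne_zero _ (by exact_mod_cast Nat.factorial_ne_zero m')) ?_
    exact ((Matrix.isUnit_iff_isUnit_det _).mp
      (Matrix.mulVec_injective_iff_isUnit.mp mrHess_mulVec_injective)).ne_zero
  have hcard : 2 * m + 1 ≤ Fintype.card (Fin (m' + 3) × Fin (m' + 3)) := by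
    rw [Fintype.card_prod, Fintype.card_fin, ← sq]
    exact hmn
  obtain ⟨r, c, hM⟩ := exists_submatrix_det_ne_zero _ hHperU hcard
  -- the Mignon–Ressayre point is a smooth zero (Euler's identity, `H` injective, `y₀ ≠ 0`)
  have hhom : (perPoly (Fin (m' + 3)) ℂ).IsHomogeneous (m' + 3) := by
    simpa [Fintype.card_fin] using (perPoly_isHomogeneous (n := Fin (m' + 3)) (k := ℂ))
  obtain ⟨hE1, -⟩ := euler_transl (perPoly (Fin (m' + 3)) ℂ) hhom (mrPoint ℂ m')
  have hlin : linPart (transl (mrPoint ℂ m') (perPoly (Fin (m' + 3)) ℂ)) ≠ 0 := by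
    intro h0
    rw [h0, smul_zero, hess0_transl_mrPoint_perPoly, Matrix.smul_mulVec] at hE1
    have h1 : mrHess ℂ m' *ᵥ mrPoint ℂ m' = 0 :=
      (smul_eq_zero.mp hE1).resolve_left (by exact_mod_cast Nat.factorial_ne_zero m')
    have hy0 := congrFun (mrHess_mulVec_eq_zero_imp _ h1) ((0 : Fin (m' + 3)), (0 : Fin (m' + 3)))
    rw [mrPoint_apply, if_pos ⟨rfl, rfl⟩, Pi.zero_apply, neg_eq_zero] at hy0
    have hm2 : ((m' : ℂ) + 2) ≠ 0 := by exact_mod_cast (Nat.succ_ne_zero _ : m' + 2 ≠ 0)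
    exact hm2 hy0
  obtain ⟨e, he⟩ := Function.ne_iff.mp hlin
  rw [Pi.zero_apply, linPart_apply, pderiv_transl, constantCoeff_transl] at he
  refine ⟨mrPoint ℂ m', e, (Matrix.of fun a b => (C (if r a = c b then (2 : ℂ) else 1) *
      X (Finsupp.single (r a) 1 + Finsupp.single (c b) 1) :
        MvPolynomial ((Fin (m' + 3) × Fin (m' + 3)) →₀ ℕ) ℂ)).det,
    eval_mrPoint_perPoly, he, ?_, ?_, ?_⟩
  · -- degree `≤ 2m + 1`
    exact totalDegree_det_hessFunctional_le r c
  · -- non-vanishing at the permanent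
    rw [eval_coeff_det_hessFunctional]
    exact hM
  · -- vanishing on the pencils `Λ_{i₀} + Σ_e X_e Z_e`
    intro Z
    rw [eval_coeff_det_hessFunctional]
    apply det_submatrix_eq_zero_of_rank_lt
    have hrank := rank_hess0_det_le _ (totalDegree_lamPencil_le i₀ Z)
      (constantCoeff_det_lamPencil i₀ Z)
    omega

end Summit.ValiantsHypothesis.ValiantsHypothesis.Theorems.RefutationDegreeBeyondHessianNs

end
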